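import Literature.AlgebraicGeometry.Motives.CechComplexPseudoCoherentGeneralProofs
import Literature.AlgebraicGeometry.Motives.GrothendieckComplexSectionAlongCech
import HarnessLib

/-!
# `cechComplex_pseudoCoherent` holds (Görtz–Wedhorn II, Thm. 23.133 / Cor. 23.135)

The named fact `cechComplex_pseudoCoherent` (`Motives/GrothendieckComplexCech`: for `K` a field,
`X → Spec K` proper and geometrically integral, `T` an integral `K`-scheme with `X ×_K T` integral,
`D` a Cartier divisor on `X ×_K T`, `V ⊆ T` an affine open and `𝔚` a Čech cover of `pr_T⁻¹ V`, the
ordered Čech complex `Č•(𝔚, 𝒪(D))` admits a quasi-isomorphism from a bounded above complex of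
finitely generated free `Γ(V, 𝒪_T)`-modules) is the special case of the named fact
`cechComplex_pseudoCoherent_general` (`Motives/GrothendieckComplexSectionAlongCech`, the same
statement without the two integrality hypotheses on `X` and `T`), via the proved
`cechComplex_pseudoCoherent_of_general`; the general fact is discharged by
`cechComplex_pseudoCoherent_general_holds` (`Motives/CechComplexPseudoCoherentGeneralProofs`:
finiteness of coherent cohomology of proper morphisms via Chow's lemma and Serre's theorems with the
rank-one dévissage of Thm. 23.17, Step (I); noetherian approximation, Step (IV); and the finite free
resolution of a bounded above complex with finitely generated cohomology over a noetherian ring,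
Prop. 21.162 / Cor. 22.62 — all proved in the tree).

Everything is proved; no named facts are introduced; no statement is changed.

## References

* U. Görtz, T. Wedhorn, *Algebraic Geometry II: Cohomology of Schemes. With Examples and
  Exercises*, Springer Spektrum (2023), doi:10.1007/978-3-658-43031-3: Thm. 23.133 and its proof,
  Steps (I)–(IV) (pp. 478–479); Cor. 23.135 (p. 480); Thm. 23.17, Cor. 23.18 (pp. 424–425);
  Prop. 21.162 (p. 311); Cor. 22.62 (p. 365); Thm. 22.9 (p. 332). [GortzWedhorn2023]
-/

namespace Literature.AlgebraicGeometry.Motives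

universe u

/-- **Görtz–Wedhorn II, Thm. 23.133 / Cor. 23.135 for the Čech complex of `𝒪(D)`**: the named fact
`cechComplex_pseudoCoherent` holds — for `K` a field, `X → Spec K` proper and geometrically
integral, `T` an integral `K`-scheme with `X ×_K T` integral, `D` a Cartier divisor on `X ×_K T`,
`V ⊆ T` an affine open and `𝔚` a Čech cover of `pr_T⁻¹V`, there are a cochain complex `F` of
finitely generated free `Γ(V, 𝒪_T)`-modules, zero above some degree, and a quasi-isomorphism
`F → Č•(𝔚, 𝒪(D))`. It is the specialisation (`cechComplex_pseudoCoherent_of_general`) of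
`cechComplex_pseudoCoherent_general`, discharged by `cechComplex_pseudoCoherent_general_holds`.
[cite: GortzWedhorn2023, Thm. 23.133 (pp. 478–479) and Cor. 23.135 (p. 480), with Thm. 23.17 / Cor. 23.18 (pp. 424–425) and Prop. 21.162 (p. 311)] -/
theorem cechComplex_pseudoCoherent_holds : cechComplex_pseudoCoherent.{u} :=
  cechComplex_pseudoCoherent_of_general cechComplex_pseudoCoherent_general_holds

end Literature.AlgebraicGeometry.Motives
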